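import Summits.AnomalousDissipation.AnomalousDissipation.Theorems.BaireTransferDenseLoudDesignerForcesErgodicModelMixedDerivativeFieldDeriv
import Literature.Analysis.FluidPDE.TorusNSLinearisationContinuityH1

/-!
# The candidate mixed operator of the smooth model is continuous at the base point in operator norm (tools for the
# registered stub S6c₂ `stub_modelMixedDerivativeFieldTools`, line ergodic-budget-selection-closing, block N-R of the crux
# `DenseLoudDesignerForces`)

Summit-side glue over `…ErgodicModelMixedDerivativeFieldDeriv.lean`.  For the operator field `Φ` of `exists_mixedOp` built
from the data at a base point `(t, y₀)` we prove (`mixedOp_norm_sub_le`): for every `ε₀ > 0` there is `θ > 0` such that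
`‖Φ s y − Φ t y₀‖ ≤ ε₀` for admissible `(s, y)` with `|s − t|, ‖y − y₀‖ < θ`.  On unit vectors `h`,
`(Φ s y − Φ t y₀) h = S([X] − [ΔX])` with `X = DG(u_y(s))[w] − DG(u_{y₀}(t))[w']` (`w, w'` the smooth representatives of
`S(W(s, y) h)`, `S(W(t, y₀) h)`), and `‖X‖²_{H¹} ≤ K(ε_w + ε_u)` (`Torus.exists_h1_linearisation_sub_le`) where the `H³`-sums
`ε_w` of `w − w'` and `ε_u` of `u_y(s) − u_{y₀}(t)` are small by Gevrey interpolation: both differences are Gevrey-bounded and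
small in `L²` — `∫‖w − w'‖² = ‖S((W(s, y) − W(t, y₀)) h)‖²` by the joint continuity of `W` (`hW`) and
`∫‖u_y(s) − u_{y₀}(t)‖² = ‖S(g s y − g t y₀)‖²` by the joint continuity of `g` (`hcont`).  Nothing is asserted; no definition
is added.
-/

set_option linter.dupNamespace false

noncomputable section

open Set Function MeasureTheory Filter Metric Asymptotics
open scoped InnerProductSpace RealInnerProductSpace Topology ContDiff

namespace Summit.AnomalousDissipation.AnomalousDissipation.Theorems.DenseLoudDesignerForces.Ergodic

open Literature.Analysis.FunctionSpaces Literature.Analysis.FunctionSpaces.Torus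
open Literature.Analysis.FluidPDE Literature.Analysis.FluidPDE.Torus
open Summit.AnomalousDissipation.AnomalousDissipation.Theses.BaireTransfer
open Summit.AnomalousDissipation.AnomalousDissipation.Theorems.DenseLoudDesignerForces.Negative

/-- **`H³`-sums of a difference that is Gevrey-bounded and `L²`-small**: if the Gevrey interpolation threshold `δ₇` (level
`2G₁ + 2G₂`, target `ε'`) is met — `v, w` smooth with Gevrey sums `≤ G₁`, `≤ G₂` and `∫‖v − w‖² ≤ δ₇` — then the `H³`-sums of
`v − w` are `≤ ε'`. [folklore] -/
theorem sobolev_sub_le_of_interp {σ G₁ G₂ δ₇ ε' : ℝ}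
    (hT7 : ∀ c' : (Fin 3 → ℤ) → EuclideanSpace ℂ (Fin 3),
      (∀ S' : Finset (Fin 3 → ℤ), ∑ k ∈ S', Real.exp (2 * σ * Real.sqrt (freqNormSq k)) * ‖c' k‖ ^ 2 ≤ 2 * G₁ + 2 * G₂) →
      (∀ S' : Finset (Fin 3 → ℤ), ∑ k ∈ S', ‖c' k‖ ^ 2 ≤ δ₇) →
      ∀ S' : Finset (Fin 3 → ℤ), ∑ k ∈ S', (1 + freqNormSq k) ^ 3 * ‖c' k‖ ^ 2 ≤ ε')
    {v w : (UnitAddTorus (Fin 3)) → (EuclideanSpace ℝ (Fin 3))} (hv : IsSmooth v) (hw : IsSmooth w)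
    (hGv : ∀ S' : Finset (Fin 3 → ℤ), ∑ k ∈ S', Real.exp (2 * σ * Real.sqrt (freqNormSq k)) *
      ‖UnitAddTorus.mFourierCoeff (EuclideanSpace.complexify ∘ v) k‖ ^ 2 ≤ G₁)
    (hGw : ∀ S' : Finset (Fin 3 → ℤ), ∑ k ∈ S', Real.exp (2 * σ * Real.sqrt (freqNormSq k)) *
      ‖UnitAddTorus.mFourierCoeff (EuclideanSpace.complexify ∘ w) k‖ ^ 2 ≤ G₂)
    (hL2 : (∫ x, ‖v x - w x‖ ^ 2) ≤ δ₇) (S' : Finset (Fin 3 → ℤ)) :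
    ∑ k ∈ S', (1 + freqNormSq k) ^ 3 * ‖UnitAddTorus.mFourierCoeff (EuclideanSpace.complexify ∘ fun x => v x - w x) k‖ ^ 2 ≤ ε' := by
  refine hT7 _ (gevrey_sub_le hv hw hGv hGw) (fun S'' => ?_) S'
  exact (sum_le_hasSum S'' (fun k _ => sq_nonneg _) (hasSum_sq_norm_mFourierCoeff_complexify ((hv.sub hw).memLp 2))).trans hL2

/-- Metric form of continuity within a set for maps into a normed group: `‖f x' − f x‖ < ε` for `x' ∈ s` near `x`. [folklore] -/
theorem exists_forall_norm_sub_lt_of_continuousWithinAt {X G : Type*} [PseudoMetricSpace X] [NormedAddCommGroup G] {f : X → G}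
    {s : Set X} {x : X} (h : ContinuousWithinAt f s x) {ε : ℝ} (hε : 0 < ε) :
    ∃ δ > (0 : ℝ), ∀ x' ∈ s, dist x' x < δ → ‖f x' - f x‖ < ε := by
  obtain ⟨δ, hδ, h'⟩ := Metric.continuousWithinAt_iff.1 h ε hε
  exact ⟨δ, hδ, fun x' hx' hd => by rw [← dist_eq_norm]; exact h' hx' hd⟩

section Continuity

variable {S : Finset (Fin 3 → ℤ)} {c : ↥S → (EuclideanSpace ℂ (Fin 3))} {ν : ℝ} (F : ModelFrame) (xF : Hsp) {U U' : Set Hsp}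
  (u : Hsp → ℝ → (UnitAddTorus (Fin 3)) → (EuclideanSpace ℝ (Fin 3))) (p : Hsp → ℝ → (UnitAddTorus (Fin 3)) → ℝ)

-- operator norms on `Hsp →L[ℝ] Hsp` through the submodule `Hsp` are slow to synthesise, and the estimate manipulates large
-- explicit field expressions; give the elaborator room
set_option synthInstance.maxHeartbeats 400000 in
set_option maxHeartbeats 800000 in
/-- **The candidate mixed operator is continuous at the base point in operator norm.**  In the setting of `exists_mixedOp` with
the data attached to a base point `(t, y₀)` (`t ∈ [3a, 3]`, `t − a = r₀`), for every `ε₀ > 0` there is `θ > 0` such that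
`‖Φ s y − Φ t y₀‖ ≤ ε₀` for all admissible `(s, y)` with `|s − t| < θ`, `‖y − y₀‖ < θ` (on unit vectors the difference is the
frame of `DG(u_y(s))[w] − DG(u_{y₀}(t))[w']`, whose `H¹` size is `≤ K(ε_w + ε_u)`, `Torus.exists_h1_linearisation_sub_le`, with
`ε_w, ε_u` small by Gevrey interpolation and the joint continuity of `W` and `g`). [folklore] -/
theorem mixedOp_norm_sub_le (hsol : ∀ y ∈ U, IsClassicalNSSolutionOn (Ioc 0 3) ν (fun _ => force S c) (u y) (p y))
    (hzm : ∀ y ∈ U, ∀ t ∈ Ioc (0 : ℝ) 3, HasZeroMean (u y t))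
    (hSu : ∀ y ∈ U, ∀ t ∈ Ioc (0 : ℝ) 3, F.S (F.modelMap ν xF U' t y) = stateOf (u y t)) (hU : IsOpen U)
    (hsmooth : ∀ t ∈ Icc (0 : ℝ) 3, ContDiffOn ℝ ∞ (fun y => F.modelMap ν xF U' t y) U)
    (hcont : ContinuousOn (fun q : ℝ × Hsp => F.modelMap ν xF U' q.1 q.2) (Icc (0 : ℝ) 3 ×ˢ U))
    (hW : ContinuousOn (fun q : ℝ × Hsp => fderiv ℝ (fun y => F.modelMap ν xF U' q.1 y) q.2) (Ioc (0 : ℝ) 3 ×ˢ U))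
    {a σ₁ C₁ σ₂ C₂ : ℝ} (ha : 0 < a) (hσ₁ : 0 < σ₁) (hσ₂ : 0 < σ₂) (hC₂ : 0 ≤ C₂)
    (hG₁ : ∀ y ∈ U, ∀ s ∈ Icc (2 * a) 3, ∀ S' : Finset (Fin 3 → ℤ), ∑ k ∈ S', Real.exp (2 * σ₁ * Real.sqrt (freqNormSq k)) *
        ‖UnitAddTorus.mFourierCoeff (EuclideanSpace.complexify ∘ u y s) k‖ ^ 2 ≤ C₁)
    (hLipG : ∀ y ∈ U, ∀ y' ∈ U, ∀ s ∈ Icc (3 * a) 3, ∀ S' : Finset (Fin 3 → ℤ),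
      ∑ k ∈ S', Real.exp (2 * σ₂ * Real.sqrt (freqNormSq k)) *
        ‖UnitAddTorus.mFourierCoeff (EuclideanSpace.complexify ∘ fun x => u y s x - u y' s x) k‖ ^ 2 ≤
        C₂ * ‖F.modelMap ν xF U' (s - a) y - F.modelMap ν xF U' (s - a) y'‖ ^ 2)
    {ε ρ L r₀ : ℝ} {y₀ : Hsp} (hρ : 0 < ρ) (hballU : ball y₀ ρ ⊆ U)
    (hLip : ∀ r ∈ Icc (r₀ - ε) (r₀ + ε), ∀ y ∈ ball y₀ ρ, ∀ y' ∈ ball y₀ ρ,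
      ‖F.modelMap ν xF U' r y - F.modelMap ν xF U' r y'‖ ≤ L * ‖y - y'‖)
    {Φ : ℝ → Hsp → (Hsp →L[ℝ] Hsp)}
    (hΦ : ∀ s ∈ Icc (3 * a) 3, s - a ∈ Icc (r₀ - ε) (r₀ + ε) → ∀ y ∈ ball y₀ (ρ / 2),
      ∀ (h : Hsp) (w : (UnitAddTorus (Fin 3)) → (EuclideanSpace ℝ (Fin 3))), IsSmooth w → IsDivFree w → HasZeroMean w →
        stateOf w = F.S (fderiv ℝ (fun y' => F.modelMap ν xF U' s y') y h) →
        Φ s y h = F.S (stateOf (fun x => (ν • laplacian w x - (convect (u y s) w x + convect w (u y s) x)) -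
            Torus.gradient (invLaplacian (divergence fun z => ν • laplacian w z - (convect (u y s) w z + convect w (u y s) z))) x) -
          stateOf (laplacian fun x => (ν • laplacian w x - (convect (u y s) w x + convect w (u y s) x)) -
            Torus.gradient (invLaplacian (divergence fun z => ν • laplacian w z - (convect (u y s) w z + convect w (u y s) z))) x)))
    {t : ℝ} (ht : t ∈ Icc (3 * a) 3) (htr : t - a ∈ Icc (r₀ - ε) (r₀ + ε)) {ε₀ : ℝ} (hε₀ : 0 < ε₀) :
    ∃ θ > (0 : ℝ), ∀ (s : ℝ) (y : Hsp), s ∈ Icc (3 * a) 3 → s - a ∈ Icc (r₀ - ε) (r₀ + ε) → y ∈ ball y₀ (ρ / 2) →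
      |s - t| < θ → ‖y - y₀‖ < θ → ‖Φ s y - Φ t y₀‖ ≤ ε₀ := by
  obtain ⟨K, hK0, hK⟩ := exists_h1_linearisation_sub_le (d := Fin 3) (Fintype.card_fin 3) ν σ₁ C₁ σ₂ (C₂ * L ^ 2) hσ₁ hσ₂
  have hy₀U : y₀ ∈ U := hballU (mem_ball_self hρ)
  have hy₀b : y₀ ∈ ball y₀ (ρ / 2) := mem_ball_self (by positivity)
  have ht0 : 0 < t := by linarith [ht.1]
  have ht3 : t ∈ Ioc (0 : ℝ) 3 := ⟨ht0, ht.2⟩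
  have hut : IsSmooth (u y₀ t) := (hsol y₀ hy₀U).smooth_velocity.isSmooth_slice ht3
  -- thresholds
  set ε' : ℝ := ε₀ ^ 2 / (2 * (K + 1)) with hε'
  have hε'0 : 0 < ε' := by positivity
  obtain ⟨δw, hδw, hT7w⟩ := exists_sobolev_le_of_gevreyBound_of_l2_le (d := Fin 3) (V := EuclideanSpace ℂ (Fin 3)) σ₂
    (2 * (C₂ * L ^ 2) + 2 * (C₂ * L ^ 2)) hσ₂ (by positivity) 3 ε' hε'0
  obtain ⟨δu, hδu, hT7u⟩ := exists_sobolev_le_of_gevreyBound_of_l2_le (d := Fin 3) (V := EuclideanSpace ℂ (Fin 3)) σ₁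
    (2 * C₁ + 2 * C₁) hσ₁ (by linarith [gevreyBound_nonneg (hG₁ y₀ hy₀U t ⟨by linarith [ht.1], ht.2⟩)]) 3 ε' hε'0
  set NS : ℝ := ‖F.S‖ with hNS
  have hNS0 : 0 ≤ NS := F.S.opNorm_nonneg
  set ηw : ℝ := Real.sqrt δw / (NS + 1) with hηw
  have hηw0 : 0 < ηw := by positivity
  set ηu : ℝ := Real.sqrt δu / (NS + 1) with hηu
  have hηu0 : 0 < ηu := by positivity
  have hsqw : (NS * ηw) ^ 2 ≤ δw := by
    have h2 : NS * ηw ≤ Real.sqrt δw := by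
      rw [hηw, mul_div_assoc', div_le_iff₀ (by positivity)]; nlinarith [Real.sqrt_nonneg δw]
    calc (NS * ηw) ^ 2 ≤ Real.sqrt δw ^ 2 := pow_le_pow_left₀ (by positivity) h2 2
      _ = δw := Real.sq_sqrt hδw.le
  have hsqu : (NS * ηu) ^ 2 ≤ δu := by
    have h2 : NS * ηu ≤ Real.sqrt δu := by
      rw [hηu, mul_div_assoc', div_le_iff₀ (by positivity)]; nlinarith [Real.sqrt_nonneg δu]
    calc (NS * ηu) ^ 2 ≤ Real.sqrt δu ^ 2 := pow_le_pow_left₀ (by positivity) h2 2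
      _ = δu := Real.sq_sqrt hδu.le
  -- moduli of continuity of `W` and `g` at `(t, y₀)`
  obtain ⟨θ₁, hθ₁, hθ₁W⟩ := exists_forall_norm_sub_lt_of_continuousWithinAt
    (f := fun q : ℝ × Hsp => fderiv ℝ (fun y => F.modelMap ν xF U' q.1 y) q.2) (hW (t, y₀) ⟨ht3, hy₀U⟩) hηw0
  obtain ⟨θ₂, hθ₂, hθ₂g⟩ := exists_forall_norm_sub_lt_of_continuousWithinAt
    (f := fun q : ℝ × Hsp => F.modelMap ν xF U' q.1 q.2) (hcont (t, y₀) ⟨⟨ht0.le, ht.2⟩, hy₀U⟩) hηu0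
  refine ⟨min θ₁ θ₂, lt_min hθ₁ hθ₂, fun s y hs hsr hy hst hyt => ?_⟩
  have hs0 : 0 < s := by linarith [hs.1]
  have hs3 : s ∈ Ioc (0 : ℝ) 3 := ⟨hs0, hs.2⟩
  have hyρ : y ∈ ball y₀ ρ := ball_subset_ball (by linarith) hy
  have hyU : y ∈ U := hballU hyρ
  have hus : IsSmooth (u y s) := (hsol y hyU).smooth_velocity.isSmooth_slice hs3
  have hdist : dist (s, y) (t, y₀) < min θ₁ θ₂ := by
    rw [Prod.dist_eq, Real.dist_eq, dist_eq_norm]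
    exact max_lt hst hyt
  have hWd := hθ₁W (s, y) ⟨hs3, hyU⟩ (hdist.trans_le (min_le_left _ _))
  have hgd := hθ₂g (s, y) ⟨⟨hs0.le, hs.2⟩, hyU⟩ (hdist.trans_le (min_le_right _ _))
  dsimp only at hWd hgd
  -- the `H³`-sum of `u_y(s) − u_{y₀}(t)`
  obtain ⟨hη, hηd, hηm⟩ := honest_sub hus ((hsol y hyU).divFree s hs3) (hzm y hyU s hs3) hut ((hsol y₀ hy₀U).divFree t ht3)
    (hzm y₀ hy₀U t ht3)
  have huL2 : (∫ x, ‖u y s x - u y₀ t x‖ ^ 2) ≤ δu := by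
    rw [← norm_stateOf_sub_sq hus ((hsol y hyU).divFree s hs3) (hzm y hyU s hs3) hut ((hsol y₀ hy₀U).divFree t ht3) (hzm y₀ hy₀U t ht3),
      ← hSu y hyU s hs3, ← hSu y₀ hy₀U t ht3, ← map_sub]
    have h1 : ‖F.S (F.modelMap ν xF U' s y - F.modelMap ν xF U' t y₀)‖ ≤ NS * ηu :=
      (F.S.le_opNorm _).trans (mul_le_mul_of_nonneg_left hgd.le hNS0)
    exact (pow_le_pow_left₀ (norm_nonneg _) h1 2).trans hsqu
  have huSob := sobolev_sub_le_of_interp hT7u hus hut (hG₁ y hyU s ⟨by linarith [hs.1], hs.2⟩) (hG₁ y₀ hy₀U t ⟨by linarith [ht.1], ht.2⟩) huL2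
  -- the operator norm on unit vectors
  refine ContinuousLinearMap.opNorm_le_of_unit_norm hε₀.le fun h hh1 => ?_
  obtain ⟨w, hw, hwd, hwm, hwG, hstw⟩ := exists_smooth_rep_fderiv F xF u p hsol hzm hSu hU hsmooth hσ₂ hC₂ hLipG hρ hballU
    hLip hs hs0 hsr hy h
  obtain ⟨w', hw', hw'd, hw'm, hw'G, hstw'⟩ := exists_smooth_rep_fderiv F xF u p hsol hzm hSu hU hsmooth hσ₂ hC₂ hLipG hρ hballU
    hLip ht ht0 htr hy₀b h
  rw [hh1, one_pow, mul_one] at hwG hw'G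
  obtain ⟨⟨hLw, hLwd, hLwm⟩, -⟩ := honest_leray_linearisation ν hus ((hsol y hyU).divFree s hs3) hw hwd
  obtain ⟨⟨hLw', hLw'd, hLw'm⟩, -⟩ := honest_leray_linearisation ν hut ((hsol y₀ hy₀U).divFree t ht3) hw' hw'd
  -- the `H³`-sum of `w − w'`
  obtain ⟨hr, hrd, hrm⟩ := honest_sub hw hwd hwm hw' hw'd hw'm
  have hwL2 : (∫ x, ‖w x - w' x‖ ^ 2) ≤ δw := by
    rw [← norm_stateOf_sub_sq hw hwd hwm hw' hw'd hw'm, hstw, hstw', ← map_sub, ← _root_.sub_apply]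
    have h1 : ‖F.S ((fderiv ℝ (fun y' => F.modelMap ν xF U' s y') y - fderiv ℝ (fun y' => F.modelMap ν xF U' t y') y₀) h)‖ ≤
        NS * ηw := by
      refine (F.S.le_opNorm _).trans (mul_le_mul_of_nonneg_left ?_ hNS0)
      refine (ContinuousLinearMap.le_opNorm _ _).trans ?_
      rw [hh1, mul_one]
      exact hWd.le
    exact (pow_le_pow_left₀ (norm_nonneg _) h1 2).trans hsqw
  have hwSob := sobolev_sub_le_of_interp hT7w hw hw' hwG hw'G hwL2
  -- the continuity estimate
  have hest := hK (u y s) (u y₀ t) w w' hus hut hw hw' hηm hrm (hG₁ y hyU s ⟨by linarith [hs.1], hs.2⟩) hw'G ε' hwSob ε' huSob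
  rw [_root_.sub_apply, hΦ s hs hsr y hy h w hw hwd hwm hstw, hΦ t ht htr y₀ hy₀b h w' hw' hw'd hw'm hstw']
  have hsq : ‖F.S (stateOf (fun x => (ν • laplacian w x - (convect (u y s) w x + convect w (u y s) x)) -
            Torus.gradient (invLaplacian (divergence fun z => ν • laplacian w z - (convect (u y s) w z + convect w (u y s) z))) x) -
          stateOf (laplacian fun x => (ν • laplacian w x - (convect (u y s) w x + convect w (u y s) x)) -
            Torus.gradient (invLaplacian (divergence fun z => ν • laplacian w z - (convect (u y s) w z + convect w (u y s) z))) x)) -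
      F.S (stateOf (fun x => (ν • laplacian w' x - (convect (u y₀ t) w' x + convect w' (u y₀ t) x)) -
            Torus.gradient (invLaplacian (divergence fun z => ν • laplacian w' z - (convect (u y₀ t) w' z + convect w' (u y₀ t) z))) x) -
          stateOf (laplacian fun x => (ν • laplacian w' x - (convect (u y₀ t) w' x + convect w' (u y₀ t) x)) -
            Torus.gradient (invLaplacian (divergence fun z => ν • laplacian w' z - (convect (u y₀ t) w' z + convect w' (u y₀ t) z))) x))‖ ^ 2 ≤
      ε₀ ^ 2 := by
    rw [F.norm_frame_sub_sq hLw hLwd hLwm hLw' hLw'd hLw'm]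
    refine hest.trans ?_
    have : K * ε' ≤ ε₀ ^ 2 / 2 := by
      rw [hε', show K * (ε₀ ^ 2 / (2 * (K + 1))) = (K * ε₀ ^ 2) / (2 * (K + 1)) by ring, div_le_iff₀ (by positivity)]
      nlinarith [sq_nonneg ε₀]
    nlinarith
  have hfin := (pow_le_pow_iff_left₀ (norm_nonneg _) hε₀.le two_ne_zero).1 hsq
  simpa [hh1] using hfin

end Continuity

end Summit.AnomalousDissipation.AnomalousDissipation.Theorems.DenseLoudDesignerForces.Ergodic

end
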